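/-
Copyright (c) 2026 the pub-hodgecm-mathlib formalisation cell (harness21).  Prover seat hodgecm-mathlib-K2Liu-p08 (g5): Track B «K2-LIT»,
#184♮ = hLiu418 = stmt-HodgeConjecture-24832; #42S organ S1, the (G) organ at a SPLIT place — FILE «graph»: `P_Δ` IS READ OFF ONE PLACE
(the first brick of the split twin of ★ (R-a) `K2LiuLocalSWMiddleCellBruhat.offBigCell_cases`; LEAD F0P6-plan (g14) BATCH #44 «split twins = p08»).
-/
import Literature.NumberTheory.GelbartRogawski1991.LocalDoubledUnitaryIwahori          -- ★ `isSiegelDelta_iff_blkC_eq_zero`, `matA`, adapted blocks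
import Literature.NumberTheory.GelbartRogawski1991.LocalDoubledUnitaryLagrangians      -- ★ `cstar_matA` (the unitarity relations of `matA g`)
import Literature.NumberTheory.GelbartRogawski1991.LocalDoubledUnitaryUnramifiedCell   -- ★ `isUnit_det_gramS'`
import Literature.NumberTheory.GelbartRogawski1991.DoubledUnitaryAdaptedRelations      -- ★ `rel₁₁`, `rel₂₁`
import Literature.NumberTheory.Automorphic.UnitaryGroupSplitPlace                      -- ★ `PlacesOver.eq_or_eq_galInv`, `PlacesOver.galInv_galInv`
import HarnessLib

/-!
# Crux `HLiu418`, #42S organ S1, (G) organ, FILE «graph»: FOR `g ∈ H(F_v)`, THE CORNER `C(g)` VANISHES AS SOON AS IT VANISHES AT ONE PLACE `w ∣ v`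

Cell `hodgecm-mathlib`, crux item hLiu418 = `stmt-HodgeConjecture-24832`, route of record `HCCMUnconditional`; squad K2 ∕ K2Liu, road `K2_Liu`, socket
#42S (a), organ S1; LEAD F0P6-plan (g14).  THEOREMS ONLY (no `def`, no `instance`, no `notation`, no named-fact hypothesis, no `sorry`);
lane `--supports stmt-HodgeConjecture-24832` (count-neutral helper).

WHY.  At a place `v` of `F` SPLIT in `E` the local algebra `E ⊗ F_v = Π_{w ∣ v} E_w` has two factors and `H(F_v) = U(𝔻)(F_v) ≅ GL_{2n}(F_v)`: the second component
of `g` is determined by the first.  The cell decomposition off the big cell (★ (R-a) `offBigCell_cases`, stated for `E ⊗ F_v` a field) must be redone at split places; its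
first brick is this «graph» property of the Siegel parabolic: **if the adapted corner `C(g)` (★ `blkC (matA g)`) vanishes at ONE place `w ∣ v`, it vanishes** — so `g ∈ P_Δ(F_v)`
(★ `isSiegelDelta_iff_blkC_eq_zero`).  PROOF (valid at every place, split or not): write `w̄ = c⁻¹ • w` (★ `PlacesOver.galInv`); the unitarity relations of ★ `cstar_matA` in
adapted blocks (★ `rel₂₁`: `Dᴴ S A + Bᴴ S C = S`, ★ `rel₁₁`: `Cᴴ S A + Aᴴ S C = 0`, `Xᴴ = σ(X)ᵀ`, `S = gramS`) READ AT A PLACE through `Matrix.map (Pi.evalRingHom _ w)`, and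
`(Xᴴ)(w) = (c_* X(w̄))ᵀ` (§1).  If `C(w̄) = 0`, `rel₂₁` at `w̄` gives `Dᴴ(w̄) S(w̄) A(w̄) = S(w̄)`, so `det A(w̄) ≠ 0`; `rel₁₁` at `w` gives `Aᴴ(w) S(w) C(w) = 0` with
`Aᴴ(w) = (c_* A(w̄))ᵀ` invertible, hence `C(w) = 0` (§2).  Since the places above `v` are `w, c⁻¹ • w` (★ `PlacesOver.eq_or_eq_galInv`, `galInv_galInv`), `C(w) = 0` at one
place forces `C = 0` (§3).
* §1 `map_eval_cstar` (`(σ(X)ᵀ)(w) = (c_* X(w̄))ᵀ`), `isUnit_det_gramS_map_eval` (`S(w)` invertible);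
* §2 **`blkC_map_eval_eq_zero_of_galInv`** (`C(w̄) = 0 ⇒ C(w) = 0`);
* §3 **`blkC_eq_zero_of_map_eval_eq_zero`**, **`isSiegelDelta_of_blkC_map_eval_eq_zero`** (`C(w) = 0 ⇒ g ∈ P_Δ(F_v)`).
References: [Kudla1994] §3 (Bruhat cells of the Siegel parabolic); [HarrisKudlaSweet1996] §1 (1.11); [CasselsFrohlichANT1967] Ch. II §10–§11, Ch. VII §1.1–1.2
(`E ⊗ F_v = Π E_w`, Galois transport of completions).
HONEST LABEL.  Count-neutral helper; it retires nothing by itself: `HC_CM` is proved only modulo the 7 printed citations (2 remaining named inputs: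
hLiu418 = `stmt-HodgeConjecture-24832`, h413 = `stmt-HodgeConjecture-24833`) until rung 0 closes.
-/

set_option autoImplicit false
-- the mandated namespace repeats the single-problem summit's segment (`HodgeConjecture.HodgeConjecture`)
set_option linter.dupNamespace false

noncomputable section

open scoped Matrix
open NumberField IsDedekindDomain Matrix
open Literature.NumberTheory.Automorphic Literature.NumberTheory.Automorphic.UnitaryGroup
open Literature.NumberTheory.GelbartRogawski1991.AdaptedBlocks
open Literature.NumberTheory.GelbartRogawski1991.UnitaryDualPair.LocalSplitting

namespace Summit.HodgeConjecture.HodgeConjecture.Cruxes.HLiu418.K2LiuSplitSiegelDeltaGraph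

variable (F : Type) [Field F] [NumberField F] (E : Type) [Field E] [NumberField E] [Algebra F E] [Algebra.IsQuadraticExtension F E]
  (c : E ≃ₐ[F] E) {δ : E} (hcδ : c δ = -δ) (hδ : δ ≠ 0) {d : F} (hd : δ * δ = algebraMap F E d)
  (v : HeightOneSpectrum (𝓞 F)) (n : ℕ) {T₀ : Matrix (Fin n) (Fin n) F} (hT₀ : T₀.IsSymm) (hT₀d : IsUnit T₀.det)
  {JD : Matrix (Fin (n + n)) (Fin (n + n)) E} (hJD : JD = (gramD F n T₀).map (algebraMap F E))

/-! ## §1 Reading a matrix over `E ⊗ F_v` at a place -/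

omit [Algebra.IsQuadraticExtension F E] in
/-- **`(σ(X)ᵀ)(w) = (c_* X(c⁻¹ • w))ᵀ`**: reading the `σ`-conjugate transpose at `w` is the transpose of the Galois transport of the reading at `w̄ = c⁻¹ • w`
(★ `conjLocal_apply`, definitional). [cite: CasselsFrohlichANT1967, Ch. VII §1.1] -/
theorem map_eval_cstar {m : Type*} (X : Matrix m m (LocalRing E v)) (w : PlacesOver E v) :
    ((X.map (conjLocal E c v))ᵀ).map (Pi.evalRingHom (fun w : PlacesOver E v => w.1.adicCompletion E) w) =
      ((X.map (Pi.evalRingHom (fun w : PlacesOver E v => w.1.adicCompletion E) (PlacesOver.galInv c w))).map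
        (galAdicCompletionMap c (smul_inv_smul c w.1)))ᵀ := by
  ext i j
  rfl

omit [Algebra.IsQuadraticExtension F E] in
include hT₀d in
/-- **`S(w)` is invertible**: the Gram matrix `gramS` read at any place `w ∣ v` has unit determinant (★ `isUnit_det_gramS'`). [cite: HarrisKudlaSweet1996, §1 (1.11)] -/
theorem isUnit_det_gramS_map_eval (w : PlacesOver E v) :
    IsUnit ((gramS F E v n T₀).map (Pi.evalRingHom (fun w : PlacesOver E v => w.1.adicCompletion E) w)).det := by
  rw [← RingHom.mapMatrix_apply, ← RingHom.map_det]
  exact (isUnit_det_gramS' F E v n hT₀d).map _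

/-! ## §2 `C(c⁻¹ • w) = 0 ⇒ C(w) = 0` -/

omit [Algebra.IsQuadraticExtension F E] in
include hJD hT₀d in
/-- **THE GRAPH STEP**: for `g ∈ H(F_v)`, if the adapted corner `C(g)` vanishes at the place `w̄ = c⁻¹ • w` then it vanishes at `w` (★ `rel₂₁` at `w̄` makes `A(w̄)` invertible;
★ `rel₁₁` at `w` then reads `(c_* A(w̄))ᵀ · S(w) · C(w) = 0`). [cite: Kudla1994, §3] [cite: HarrisKudlaSweet1996, §1 (1.11)] [cite: CasselsFrohlichANT1967, Ch. VII §1.1] -/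
theorem blkC_map_eval_eq_zero_of_galInv (g : UnitaryGroup.localPi E c (n + n) JD v) (w : PlacesOver E v)
    (h : (blkC (matA F E c v n g)).map (Pi.evalRingHom (fun w : PlacesOver E v => w.1.adicCompletion E) (PlacesOver.galInv c w)) = 0) :
    (blkC (matA F E c v n g)).map (Pi.evalRingHom (fun w : PlacesOver E v => w.1.adicCompletion E) w) = 0 := by
  have hS := isUnit_det_gramS_map_eval F E v n hT₀d w
  have hSb := isUnit_det_gramS_map_eval F E v n hT₀d (PlacesOver.galInv c w)
  -- ★ `rel₂₁` at `w̄`: `Dᴴ(w̄) S(w̄) A(w̄) = S(w̄)` (the `Bᴴ S C` term dies with `C(w̄) = 0`)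
  have r21 := congrArg ((Pi.evalRingHom (fun w : PlacesOver E v => w.1.adicCompletion E) (PlacesOver.galInv c w)).mapMatrix)
    (rel₂₁ (cstar_matA F E c v n hJD g))
  simp only [map_add, map_mul, RingHom.mapMatrix_apply] at r21
  rw [h, Matrix.mul_zero, add_zero] at r21
  have hA : IsUnit ((blkA (matA F E c v n g)).map (Pi.evalRingHom (fun w : PlacesOver E v => w.1.adicCompletion E) (PlacesOver.galInv c w))).det := by
    rw [isUnit_iff_ne_zero]
    intro hA0
    have hdet := congrArg Matrix.det r21
    rw [Matrix.det_mul, Matrix.det_mul, hA0, mul_zero] at hdet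
    exact hSb.ne_zero hdet.symm
  -- ★ `rel₁₁` at `w`: `Cᴴ(w) S(w) A(w) + Aᴴ(w) S(w) C(w) = 0`, and `Cᴴ(w) = (c_* C(w̄))ᵀ = 0`
  have r11 := congrArg ((Pi.evalRingHom (fun w : PlacesOver E v => w.1.adicCompletion E) w).mapMatrix) (rel₁₁ (cstar_matA F E c v n hJD g))
  simp only [map_add, map_mul, map_zero, RingHom.mapMatrix_apply] at r11
  rw [map_eval_cstar F E c v (blkC (matA F E c v n g)) w, h, Matrix.map_zero _ (map_zero _), Matrix.transpose_zero, Matrix.zero_mul,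
    Matrix.zero_mul, zero_add, map_eval_cstar F E c v (blkA (matA F E c v n g)) w] at r11
  -- `Aᴴ(w) = (c_* A(w̄))ᵀ` is invertible
  have hAt : IsUnit (((blkA (matA F E c v n g)).map (Pi.evalRingHom (fun w : PlacesOver E v => w.1.adicCompletion E) (PlacesOver.galInv c w))).map
      (galAdicCompletionMap c (smul_inv_smul c w.1)))ᵀ.det := by
    rw [Matrix.det_transpose, ← RingHom.mapMatrix_apply, ← RingHom.map_det]
    exact hA.map _
  -- cancel the two invertible factors: `C(w) = S(w)⁻¹ · (Aᴴ(w))⁻¹ · (Aᴴ(w) · (S(w) C(w))) = 0`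
  have e0 : (((blkA (matA F E c v n g)).map (Pi.evalRingHom (fun w : PlacesOver E v => w.1.adicCompletion E) (PlacesOver.galInv c w))).map
        (galAdicCompletionMap c (smul_inv_smul c w.1)))ᵀ * ((gramS F E v n T₀).map (Pi.evalRingHom (fun w : PlacesOver E v => w.1.adicCompletion E) w) * (blkC (matA F E c v n g)).map (Pi.evalRingHom (fun w : PlacesOver E v => w.1.adicCompletion E) w)) = 0 := by
    rw [← Matrix.mul_assoc]; exact r11
  calc (blkC (matA F E c v n g)).map (Pi.evalRingHom (fun w : PlacesOver E v => w.1.adicCompletion E) w)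
      = ((gramS F E v n T₀).map (Pi.evalRingHom (fun w : PlacesOver E v => w.1.adicCompletion E) w))⁻¹ * ((gramS F E v n T₀).map (Pi.evalRingHom (fun w : PlacesOver E v => w.1.adicCompletion E) w) * (blkC (matA F E c v n g)).map (Pi.evalRingHom (fun w : PlacesOver E v => w.1.adicCompletion E) w)) := (Matrix.nonsing_inv_mul_cancel_left _ _ hS).symm
    _ = ((gramS F E v n T₀).map (Pi.evalRingHom (fun w : PlacesOver E v => w.1.adicCompletion E) w))⁻¹ * (((((blkA (matA F E c v n g)).map (Pi.evalRingHom (fun w : PlacesOver E v => w.1.adicCompletion E) (PlacesOver.galInv c w))).map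
        (galAdicCompletionMap c (smul_inv_smul c w.1)))ᵀ)⁻¹ * ((((blkA (matA F E c v n g)).map (Pi.evalRingHom (fun w : PlacesOver E v => w.1.adicCompletion E) (PlacesOver.galInv c w))).map
        (galAdicCompletionMap c (smul_inv_smul c w.1)))ᵀ * ((gramS F E v n T₀).map (Pi.evalRingHom (fun w : PlacesOver E v => w.1.adicCompletion E) w) * (blkC (matA F E c v n g)).map (Pi.evalRingHom (fun w : PlacesOver E v => w.1.adicCompletion E) w)))) := by
        rw [Matrix.nonsing_inv_mul_cancel_left _ _ hAt]
    _ = 0 := by rw [e0, Matrix.mul_zero, Matrix.mul_zero]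

/-! ## §3 One place suffices -/

include hcδ hδ hJD hT₀d in
/-- **`C(g)` VANISHES AS SOON AS IT VANISHES AT ONE PLACE `w ∣ v`** (the places above `v` are `w` and `c⁻¹ • w`, ★ `PlacesOver.eq_or_eq_galInv`; §2 at the place `c⁻¹ • w`,
whose `galInv` is `w` again, ★ `PlacesOver.galInv_galInv`). [cite: Kudla1994, §3] [cite: CasselsFrohlichANT1967, Ch. VII Prop. 1.2 (ii)] -/
theorem blkC_eq_zero_of_map_eval_eq_zero (g : UnitaryGroup.localPi E c (n + n) JD v) (w : PlacesOver E v)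
    (h : (blkC (matA F E c v n g)).map (Pi.evalRingHom (fun w : PlacesOver E v => w.1.adicCompletion E) w) = 0) :
    blkC (matA F E c v n g) = 0 := by
  have hc : c ≠ 1 := by
    intro h1
    rw [h1, AlgEquiv.one_apply] at hcδ
    exact hδ (add_self_eq_zero.1 (eq_neg_iff_add_eq_zero.1 hcδ))
  have h' : (blkC (matA F E c v n g)).map (Pi.evalRingHom (fun w : PlacesOver E v => w.1.adicCompletion E) (PlacesOver.galInv c w)) = 0 := by
    refine blkC_map_eval_eq_zero_of_galInv F E c v n hT₀d hJD g (PlacesOver.galInv c w) ?_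
    rw [PlacesOver.galInv_galInv c hc]
    exact h
  refine Matrix.ext fun i j => funext fun w' => ?_
  rcases PlacesOver.eq_or_eq_galInv c hc w w' with rfl | rfl
  · exact congrFun (congrFun h i) j
  · exact congrFun (congrFun h' i) j

include hcδ hδ hd hT₀ hJD hT₀d in
/-- **`g ∈ P_Δ(F_v)` AS SOON AS `C(g)` VANISHES AT ONE PLACE** (the previous + ★ `isSiegelDelta_iff_blkC_eq_zero`). [cite: Kudla1994, §3] [cite: HarrisKudlaSweet1996, §1 (1.11)] -/
theorem isSiegelDelta_of_blkC_map_eval_eq_zero (g : UnitaryGroup.localPi E c (n + n) JD v) (w : PlacesOver E v)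
    (h : (blkC (matA F E c v n g)).map (Pi.evalRingHom (fun w : PlacesOver E v => w.1.adicCompletion E) w) = 0) :
    IsSiegelDelta F E c hcδ hδ hd v n hT₀ hJD g :=
  (isSiegelDelta_iff_blkC_eq_zero F E c hcδ hδ hd v n hT₀ hJD g).2 (blkC_eq_zero_of_map_eval_eq_zero F E c hcδ hδ v n hT₀d hJD g w h)

end Summit.HodgeConjecture.HodgeConjecture.Cruxes.HLiu418.K2LiuSplitSiegelDeltaGraph

end
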